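import Summits.QuantumFields.BalabanUV.Beta.GAN24.T2ShapeThreeOfF2a
import Summits.QuantumFields.BalabanUV.Beta.GAN24.WSlotSourceZeroModeHolds

/-!
# `BalabanUV.Beta.GAN24.T2ShapeThreeOfPin` — binder row G-an2-4 / (CONV-C), W-slot road «W3» (gan24-p1-g5 `SKELETON-W3.md` v1.0.2 §8.3; ENDs
# `WSlotT2OfPieces` p213240): **END #1 «T2Shape» AT an1's TABLES, `d = 3`, `Lc ≥ 2`, AND THE D1 WALL's UNIFORM W-ROW `hW₂`, FROM THE ≤-PIN
# `|cE₂| ≤ Lc^{2(3+1)}` ALONE** — ROW W3-F2a is discharged BY NAME by leaf-20-g18's `WSlotSourceZeroModeHolds.hZ_cell_base` (p215354)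

NOT IN PRINT; OUR PROOF ([folklore] composition BY NAME — zero analytic content in this file).  THIS IS A SOCKET CERTIFICATE, NOT THE §8.4 HEADLINE (END #3
`WSlotT2Tables`, the W-slot's closing sentence and the (D1) identification are the row OWNER's, gan24-p1 — absorb ∕ rename at will).  Filed on the two
«→ leaf-12 lineage» asks (leaf-20-g18 CLAIMS l.10674 ∕ l.11429, leaf-03-g22 l.11436).
HONEST FRAMING (cell contract, verbatim): «discharging `BetaPertH` makes Bałaban's UV stability UNCONDITIONAL — a real constructive-QFT result; it is NOT the
continuum limit and NOT the Clay problem.»  HONEST DEPENDENCY (verbatim): «continuum YM on T⁴ ⇐ BetaPertH ∧ nine spine estimates (0/9 proved); BetaPertH ⇐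
(D1) ∧ (D4) ∧ CAP+tail; G-an2-4 gates asym, D1 and NE2/3/4.»

PLUGS (all BY NAME, tree theorems): END #1 at an1's tables = THIS lineage's `T2ShapeThreeOfF2a.t2Shape_three_an1_of_F2a` ∕ `_symZ` and the W-row
`hW_three_an1_of_F2a` (p214420; rows F1a ∕ F3a ∕ F3b ∕ F4a ∕ F4c, the K-slot, W3-MIX and the bracket's block covariance inside, by name); ROW W3-F2a (cell
conjunct of the `Zfree` of record, every member `m`, base root `vh₂S 3 Lc`, an1's `mixFFAt (toSite r) Lc`) = leaf-20-g18's `WSlotSourceZeroModeHolds.hZ_cell_base`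
(its channel inputs: leaf-06-g9's `ResponseExchangeStep` ∕ `ChannelBondLegs`, leaf-14's `MixedChannelBondSums`, leaf-11's `bracket_translate_block`).

WHAT (`d = 3`, `2 ≤ Lc`, `r ∈ box (3+1) Lc`, `hpin : |cE₂| ≤ (Lc:ℝ)^(2*(3+1))`; every colour constant and the colour tensor `Tc` symbolic):
* **`t2Shape_three_an1_of_hpin`** — «T2Shape»: `∃ C₂ δ₂, 0 < δ₂ ∧ ∀ j, LocStencil₂ (unitS₂_j (T2Of 3 Lc cE cVH cΛ cE₂ cB Tc (vh₂S 3 Lc) (mixFFAt (toSite r) Lc) j)) C₂ δ₂`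
  from the ≤-pin ALONE; `t2Shape_three_an1_of_hpin_symZ` — the same through the `Sym` door (`t2Shape_three_an1_of_F2a_symZ`).
* **`hW_three_an1_of_hpin`** — the D1 wall's UNIFORM W-row `hW₂`: `∃ Cw δW, 0 < δW ∧ ∀ j, VertexFamily₂ (unitW_j (WbalOf 3 Lc cE cVH cΛ (T2Of …) (mixFFAt (toSite r) Lc) j)) Lc Cw δW`
  from the ≤-pin ALONE.
* `t2Shape_three_an1_of_pinEq'` ∕ `hW_three_an1_of_pinEq'` — the exact pin `cE₂ = Lc^{2(3+1)}` implies the ≤-pin (`le_of_eq` on `|·|`), so END #1 and `hW₂`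
  at the exact pin are the SAME terms (kernel cross-check with leaf-08-g20's `W3PinCountdown`, which derives «T2Shape» ∧ «T2Drift» and the W-PAIR from the
  exact pin).
WHY THIS IS NOT A TWIN of `W3PinCountdown` (leaf-08-g20) ∕ the carver's (C31) ∕ asym1's ROAD-END: those consume the EXACT pin `hpinEq : cE₂ = +Lc^{2(3+1)}`,
which END #2 («T2Drift», F4d's pin half `hZ0`) genuinely needs (ref2 R63 §C: load-bearing at an3's `w22 N`); END #1 and the UNIFORM W-row need only the
≤-pin — the kernel record that «T2Shape» and `hW₂` hold on the WHOLE pin interval `|cE₂| ≤ Lc^{2(3+1)}` and that the exact pin is load-bearing only on the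
drift ∕ Cauchy half (`hW₂all`).
HONEST: the PIN (in either form) is an2's (P6) and is UNDISCHARGED; `hW₂all` ∕ «T2Drift» ∕ «T2SupRate» are NOT touched here; the window ∕ `hW′` ∕ the (D1)
identification are untouched; wall binders: K 2∕2 and S 2∕2 are tree theorems at `d = 3`, `Lc ≥ 2`, W 0∕2 by the referee's rule — this module instantiates
NONE; «T2Shape» as a statement about Bałaban's construction remains NOT IN PRINT; NOT «T2Shape closed» as a pin-free statement, NOT «W-slot closed» — never
under an undischarged pin; NEVER «G-an2-4 closed», NOT (CONV-C); NOT `BetaPertH`, NOT continuum, NOT Clay.  0 cited facts, 0 `def`, 0 `def … : Prop`, 0 sorry.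
Unit `b2b-balaban-gan24-formalise-leaf-12` (G-an2-4 formalisation swarm, leaf prover 12, gen 24), 2026-08-20.
-/

noncomputable section

open Literature.MathematicalPhysics.QuantumFieldTheory
open Literature.MathematicalPhysics.QuantumFieldTheory.Balaban1983to89
open Literature.MathematicalPhysics.QuantumFieldTheory.Balaban1983to89.Beta
open AffineAveraging (box toSite)
open ExpKernelCalculus (MKer VertexFamily₂)
open OneStepResolventKernel (Fib)
open BalabanCompositeJets (LocStencil₂)
open BalabanStepW2 (T2Of WbalOf)
open AveragingMixedJetTables (vh₂S mixFFAt)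
open Summit.QuantumFields.BalabanUV.Beta.HessKerDressedUnits (unitW)
open Summit.QuantumFields.BalabanUV.Beta.SecondOrderUnits (unitS₂)
open Summit.QuantumFields.BalabanUV.Beta.GAN24.CombesThomas (sfStep smStep)
open Summit.QuantumFields.BalabanUV.Beta.GAN24.StencilSlotOfE3 (one_le_of_two_le)
open Summit.QuantumFields.BalabanUV.Beta.GAN24.WSlotSourceZeroModeHolds (hZ_cell_base)
open Summit.QuantumFields.BalabanUV.Beta.GAN24.T2ShapeThreeOfF2a (t2Shape_three_an1_of_F2a t2Shape_three_an1_of_F2a_symZ hW_three_an1_of_F2a)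

namespace Summit.QuantumFields.BalabanUV.Beta.GAN24.T2ShapeThreeOfPin

variable {Lc : ℕ} [NeZero Lc] {r : Fin (3 + 1) → ℕ}

/-! ## §1 END #1 «T2Shape» at an1's tables from the ≤-pin alone -/

/-- **«T2Shape» AT an1's TABLE FROM THE ≤-PIN ALONE** [folklore composition: this lineage's END #1 `T2ShapeThreeOfF2a.t2Shape_three_an1_of_F2a` (p214420)
with ROW W3-F2a := leaf-20-g18's `WSlotSourceZeroModeHolds.hZ_cell_base` (p215354)]: at `d = 3`, `2 ≤ Lc`, `r ∈ box (3+1) Lc`, for EVERY `cE₂` with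
`|cE₂| ≤ Lc^(2(3+1))` (every other colour constant and the colour tensor `Tc` symbolic), an2's normalised Stage-B family at the base-root border `vh₂S 3 Lc`
and an1's mixed table `mixFFAt (toSite r) Lc` is ONE `LocStencil₂` family: one constant, one positive rate, all levels `j`. -/
theorem t2Shape_three_an1_of_hpin (hLc : 2 ≤ Lc) (hr : r ∈ box (3 + 1) Lc) (cE cVH cΛ cE₂ cB : ℝ)
    (Tc : Fin 4 → Fin 4 → Fin 4 → Fin 4 → ℝ) (hpin : |cE₂| ≤ (Lc : ℝ) ^ (2 * (3 + 1))) :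
    ∃ C₂ δ₂ : ℝ, 0 < δ₂ ∧ ∀ j, LocStencil₂ (unitS₂ (sfStep Lc j) (smStep 3 Lc j)
      (T2Of 3 Lc cE cVH cΛ cE₂ cB Tc (vh₂S 3 Lc) (mixFFAt (toSite r) Lc) j)) C₂ δ₂ :=
  t2Shape_three_an1_of_F2a hLc hr cE cVH cΛ cE₂ cB Tc hpin
    (hZ_cell_base (d := 3) (one_le_of_two_le hLc) hr cE cVH cΛ cE₂ cB)

/-- **«T2Shape» AT an1's TABLE FROM THE ≤-PIN ALONE, THROUGH THE `Sym` DOOR** [folklore composition: `T2ShapeThreeOfF2a.t2Shape_three_an1_of_F2a_symZ`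
(the bond-SYMMETRISED cell charges `zmode b♮_m κ κ′ ff + zmode b♮_m κ′ κ ff = 0`) with both summands := 0 by leaf-20-g18's `hZ_cell_base`] — the same
conclusion as `t2Shape_three_an1_of_hpin`; recorded because END #2 of record runs in the `ZfreeSym` currency (ref2 R63-1). -/
theorem t2Shape_three_an1_of_hpin_symZ (hLc : 2 ≤ Lc) (hr : r ∈ box (3 + 1) Lc) (cE cVH cΛ cE₂ cB : ℝ)
    (Tc : Fin 4 → Fin 4 → Fin 4 → Fin 4 → ℝ) (hpin : |cE₂| ≤ (Lc : ℝ) ^ (2 * (3 + 1))) :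
    ∃ C₂ δ₂ : ℝ, 0 < δ₂ ∧ ∀ j, LocStencil₂ (unitS₂ (sfStep Lc j) (smStep 3 Lc j)
      (T2Of 3 Lc cE cVH cΛ cE₂ cB Tc (vh₂S 3 Lc) (mixFFAt (toSite r) Lc) j)) C₂ δ₂ :=
  t2Shape_three_an1_of_F2a_symZ hLc hr cE cVH cΛ cE₂ cB Tc hpin (fun m κ κ' κ₁ κ₂ => by
    have hZ := hZ_cell_base (d := 3) (one_le_of_two_le hLc) hr cE cVH cΛ cE₂ cB m
    rw [hZ, hZ, add_zero])

/-! ## §2 The D1 wall's uniform W-row `hW₂` from the ≤-pin alone -/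

/-- **THE D1 WALL's UNIFORM W-ROW `hW₂` AT an1's TABLE FROM THE ≤-PIN ALONE** [folklore composition: this lineage's `T2ShapeThreeOfF2a.hW_three_an1_of_F2a`
(leaf-11's `WSlotMixedShape.hW_three_an1_of_T2Shape` ∘ END #1) with ROW W3-F2a := leaf-20-g18's `hZ_cell_base`]: at `d = 3`, `2 ≤ Lc`, `r ∈ box (3+1) Lc`,
for EVERY `cE₂` with `|cE₂| ≤ Lc^(2(3+1))`, `∃ Cw δW, 0 < δW ∧ ∀ j, VertexFamily₂ (unitW_j (WbalOf 3 Lc cE cVH cΛ (T2Of …) (mixFFAt (toSite r) Lc) j)) Lc Cw δW`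
— the `hW₂` binder text of `StencilSlotWallThree.d1Drift_JsBalOf_iff_three_of_wRows` for an2's Stage-B family.  The Cauchy row `hW₂all` needs «T2Drift»
(END #2, EXACT pin — leaf-08-g20's `W3PinCountdown`) and is NOT touched. -/
theorem hW_three_an1_of_hpin (hLc : 2 ≤ Lc) (hr : r ∈ box (3 + 1) Lc) (cE cVH cΛ cE₂ cB : ℝ)
    (Tc : Fin 4 → Fin 4 → Fin 4 → Fin 4 → ℝ) (hpin : |cE₂| ≤ (Lc : ℝ) ^ (2 * (3 + 1))) :
    ∃ Cw δW : ℝ, 0 < δW ∧ ∀ j, VertexFamily₂ (unitW (sfStep Lc j) (smStep 3 Lc j)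
      (WbalOf 3 Lc cE cVH cΛ (T2Of 3 Lc cE cVH cΛ cE₂ cB Tc (vh₂S 3 Lc) (mixFFAt (toSite r) Lc)) (mixFFAt (toSite r) Lc) j)) Lc Cw δW :=
  hW_three_an1_of_F2a hLc hr cE cVH cΛ cE₂ cB Tc hpin
    (hZ_cell_base (d := 3) (one_le_of_two_le hLc) hr cE cVH cΛ cE₂ cB)

/-! ## §3 The exact pin is a point of the pin interval (kernel cross-check with `W3PinCountdown`) -/

omit [NeZero Lc] in
/-- [folklore] The exact pin `cE₂ = Lc^(2(3+1))` implies the ≤-pin `|cE₂| ≤ Lc^(2(3+1))`. -/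
theorem abs_le_of_pinEq {cE₂ : ℝ} (hpinEq : cE₂ = (Lc : ℝ) ^ (2 * (3 + 1))) : |cE₂| ≤ (Lc : ℝ) ^ (2 * (3 + 1)) := by
  rw [hpinEq, abs_of_nonneg (by positivity)]

/-- **«T2Shape» AT an1's TABLE AT THE EXACT PIN** — the `t2Shape_three_an1_of_hpin` term at `abs_le_of_pinEq hpinEq`; the END #1 conjunct of leaf-08-g20's
`W3PinCountdown.t2ShapeDrift_three_an1_of_pinEq`, reached here without END #2. -/
theorem t2Shape_three_an1_of_pinEq' (hLc : 2 ≤ Lc) (hr : r ∈ box (3 + 1) Lc) (cE cVH cΛ cE₂ cB : ℝ)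
    (Tc : Fin 4 → Fin 4 → Fin 4 → Fin 4 → ℝ) (hpinEq : cE₂ = (Lc : ℝ) ^ (2 * (3 + 1))) :
    ∃ C₂ δ₂ : ℝ, 0 < δ₂ ∧ ∀ j, LocStencil₂ (unitS₂ (sfStep Lc j) (smStep 3 Lc j)
      (T2Of 3 Lc cE cVH cΛ cE₂ cB Tc (vh₂S 3 Lc) (mixFFAt (toSite r) Lc) j)) C₂ δ₂ :=
  t2Shape_three_an1_of_hpin hLc hr cE cVH cΛ cE₂ cB Tc (abs_le_of_pinEq hpinEq)

/-- **THE UNIFORM W-ROW `hW₂` AT THE EXACT PIN** — the `hW_three_an1_of_hpin` term at `abs_le_of_pinEq hpinEq`; the first row of leaf-08-g20's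
`W3PinCountdown.hW_hWall_three_an1_of_pinEq` W-PAIR, reached here without END #2 (the Cauchy row `hW₂all` is NOT touched). -/
theorem hW_three_an1_of_pinEq' (hLc : 2 ≤ Lc) (hr : r ∈ box (3 + 1) Lc) (cE cVH cΛ cE₂ cB : ℝ)
    (Tc : Fin 4 → Fin 4 → Fin 4 → Fin 4 → ℝ) (hpinEq : cE₂ = (Lc : ℝ) ^ (2 * (3 + 1))) :
    ∃ Cw δW : ℝ, 0 < δW ∧ ∀ j, VertexFamily₂ (unitW (sfStep Lc j) (smStep 3 Lc j)
      (WbalOf 3 Lc cE cVH cΛ (T2Of 3 Lc cE cVH cΛ cE₂ cB Tc (vh₂S 3 Lc) (mixFFAt (toSite r) Lc)) (mixFFAt (toSite r) Lc) j)) Lc Cw δW :=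
  hW_three_an1_of_hpin hLc hr cE cVH cΛ cE₂ cB Tc (abs_le_of_pinEq hpinEq)

end Summit.QuantumFields.BalabanUV.Beta.GAN24.T2ShapeThreeOfPin

end
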